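import Summits.NavierStokesRegularity.NavierStokesRegularity.Theorems.RungBlowupCofinal.BandLimitedCurl
import Summits.NavierStokesRegularity.NavierStokesRegularity.Theorems.RungBlowupCofinal.AncientStokesLiouville
import Summits.NavierStokesRegularity.NavierStokesRegularity.Theorems.RungBlowupCofinal.PrecessingLerayReduction
import Literature.Analysis.FluidPDE.PressureReconstruction
import Literature.Analysis.FluidPDE.PolygonCirculation
import Literature.Analysis.FluidPDE.PineauVicolRSSChaeWolf
import Literature.Analysis.FluidPDE.LeraySelfSimilarCalculus
import HarnessLib

/-!
# PURE-WAVE EXCLUSION: the linearised precessing rung-profile system at `U = 0` has trivial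
# kernel in the Type-I class — at every rung `L` and every precession rate `α`
# (route `AngularGalerkinLadder`, crux K1 `RungBlowupCofinal`; helper, theorems only)

Cell `ns-blowup`, seat `ns-blowup-circuit` (g12, AGL Lean seat). Helper file for
`stmt-NavierStokesRegularity-19959` (K1 of route №8) serving the line
`Cruxes/RungBlowupCofinal/Lines/qlwave.lean` (mean–wave rung profiles): its card's support target
**(S4) PURE-WAVE EXCLUSION**, in the natural stronger form. Part 3 of the chain (assembly);
parts 1, 2a, 2b: `BandLimitedCurl.lean`, `ClassicalWeakStokes.lean`, `AncientStokesLiouville.lean`.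

## Main statement (`eq_zero_of_linearProfile`)

Let `W : ℝ³ → ℝ³` be band-limited of degree `≤ L` (`IsBandLimited L W`), divergence free, with
the Type-I tail `‖W(y)‖ ≤ C/(‖y‖ + 1)`, and suppose it solves the LINEAR precessing profile
equation
  `−ΔW + ½W + ½DW·y + α·J₃W + ∇Q = E`                                   (J₃ = `angGen 2`)
for SOME smooth scalar `Q` and SOME co-band-limited field `E` (`IsCobandLimited L E`; no
continuity, decay or growth assumption on `E` or `Q`). Then `W = 0`.

In words: the linearisation at the trivial profile of the precessing rung-profile system (the
system `IsPrecessingRungProfile` of the line, with its pressure AND its Galerkin-defect freedom)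
is injective on the Type-I class, for every `L : ℕ` and every `α : ℝ` — the line's card §3
«no branch bifurcates from `U = 0`» made kernel WITH the defect. Specialisations:
* `pureWave_eq_zero` — the card's (S4): a mean–wave profile `(V, W)` of the line with zonal
  part `V = 0` has `W = 0` (letters of `Qlwave.IsMeanWaveProfile L n α C 0 W Q₀ Q₁ E₀ E₁`
  unfolded, the wave conjuncts being exactly the hypotheses above after `convect 0 W = 0 =
  convect W 0`); hence **both parts of every witness of stub 3 are load-bearing**
  (`zonal_ne_zero_of_wave_ne_zero`: `W ≢ 0 ⇒ V ≢ 0`; the converse `V ≢ 0 ⇒ W ≢ 0` is the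
  axisymmetric Liouville side recorded in the card) — the SSP loop «the wave maintains the
  zonal flow that maintains the wave» is forced, not chosen.

## Proof

1. `BandLimitedCurl.profileResidual_curl_eq_zero`: the linear residual
   `G = −ΔW + ½W + ½DW·y + αJ₃W` is band-limited (the operator keeps the band), `G + ∇Q = E`
   with `E` co-band, so `curl G` is band AND co-band, hence `0` — projection-free.
2. `exists_smooth_gradient_eq` (Poincaré on `ℝ³`, the tree's segment potential
   `PressureReconstruction.hasGradientAt_segmentIntegral`): `G = ∇h`, `h` smooth.
3. So `W` solves the EXACT rotating steady Leray system with pressure `−h` and "defect"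
   `(W·∇)W`; the tree's forced rotating Leray reduction (p526882
   `isClassicalNSSolutionOn_pvAnsatz_forced`) makes Pineau–Vicol's precessing field
   `u = pvAnsatz α W` a classical Navier–Stokes solution on `(−∞, 0)` FORCED BY ITS OWN
   NONLINEARITY (`convect_pvAnsatz`) — i.e. a classical solution of the homogeneous STOKES system —
   with the Type-I bound (`norm_pvAnsatz_le_of_profile`).
4. `AncientStokesLiouville.eq_zero_of_classicalStokes_typeI` (KNSS Lemma 3.1 by duality, tree):
   `u ≡ 0`; at `t = −1` the ansatz field is `W` (`pvAnsatz_neg_one`).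

LABEL: KERNEL (MODEL `NS_L`'s profile system; linear theory). Nothing here asserts a Theses
declaration; no definition, no named fact, no sorry. WHAT THIS IS NOT: not Navier–Stokes
evidence and not a statement about NONLINEAR profiles: stub 3 of the line (existence of
non-trivial mean–wave profiles) is untouched — this file says where such profiles canNOT come
from (bifurcation from zero; pure waves).
References: [cite: PineauVicol2026, (1.7), Remark 1.2 (arXiv:2607.09619 pp. 3–4)];
[cite: KochNadirashviliSereginSverak2009, Lemma 3.1 (arXiv:0709.3599v1 p. 7)];
[cite: BullardGellman1954].
-/

noncomputable section

namespace Summit.NavierStokesRegularity.AngularGalerkinLadderPureWaveExclusion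

open Set Function MeasureTheory Filter Topology InnerProductSpace
open scoped RealInnerProductSpace Laplacian ContDiff
open Literature.Analysis.FluidPDE Literature.Analysis
open Summit.NavierStokesRegularity.FluidComputer
open Summit.NavierStokesRegularity.FluidComputer.AngularLadder
open Summit.NavierStokesRegularity.AngularGalerkinLadderBandLimitedCurl
open Summit.NavierStokesRegularity.AngularGalerkinLadderAncientStokesLiouville

variable {L : ℕ} {α C : ℝ}
  {W E : EuclideanSpace ℝ (Fin 3) → EuclideanSpace ℝ (Fin 3)} {Q : EuclideanSpace ℝ (Fin 3) → ℝ}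

/-! ## §1 Smooth curl-free fields on `ℝ³` are gradients of smooth functions -/

/-- **Poincaré lemma on `ℝ³` (smooth class).** A smooth curl-free field `G` on `ℝ³` is the
gradient of a smooth function: the segment potential `h(y) = ∫₀¹ ⟪G(σy), y⟫ dσ` of the tree's
`PressureReconstruction.hasGradientAt_segmentIntegral` (the Jacobian of a curl-free field is
symmetric, `inner_fderiv_comm_of_curl_eq_zero`), smooth because `Dh = ⟪G, ·⟫` is. [folklore] -/
theorem exists_smooth_gradient_eq {G : EuclideanSpace ℝ (Fin 3) → EuclideanSpace ℝ (Fin 3)}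
    (hG : ContDiff ℝ ∞ G) (hcurl : curl G = 0) :
    ∃ h : EuclideanSpace ℝ (Fin 3) → ℝ, ContDiff ℝ ∞ h ∧ ∀ y, gradient h y = G y := by
  have hsymm : ∀ x v w : EuclideanSpace ℝ (Fin 3), ⟪fderiv ℝ G x v, w⟫ = ⟪fderiv ℝ G x w, v⟫ :=
    fun x v w => inner_fderiv_comm_of_curl_eq_zero (by rw [hcurl]; rfl) v w
  set h : EuclideanSpace ℝ (Fin 3) → ℝ := fun y => ∫ σ in (0 : ℝ)..1, ⟪G (σ • y), y⟫ with hh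
  have hgrad : ∀ y, HasGradientAt h (G y) y := fun y => hasGradientAt_segmentIntegral hG hsymm y
  have hfd : ∀ y, HasFDerivAt h (InnerProductSpace.toDual ℝ _ (G y)) y := fun y =>
    hasGradientAt_iff_hasFDerivAt.1 (hgrad y)
  have hdiff : Differentiable ℝ h := fun y => (hfd y).differentiableAt
  have hfderiv : fderiv ℝ h = fun y => InnerProductSpace.toDual ℝ _ (G y) :=
    funext fun y => (hfd y).fderiv
  refine ⟨h, ?_, fun y => (hgrad y).gradient⟩
  rw [contDiff_infty_iff_fderiv]
  refine ⟨hdiff, ?_⟩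
  rw [hfderiv]
  exact (InnerProductSpace.toDual ℝ (EuclideanSpace ℝ (Fin 3))).contDiff.comp hG

/-! ## §2 The nonlinearity of Pineau–Vicol's precessing field -/

/-- **The self-advection of the precessing ansatz field is the Leray-scaled, co-rotated
self-advection of the profile**: for `u = pvAnsatz α W`,
`(u(t)·∇)u(t)(x) = (−t)^{−3/2} R(αs) ((W·∇)W)(R(−αs)x/√−t)`, `s = −log(−t)` — rotation
covariance (`convect_conj_linearIsometryEquiv`) and the Leray scaling `(c U(c·)·∇)(c U(c·)) =
c³((U·∇)U)(c·)` (`convect_smul_comp_smul`). [cite: PineauVicol2026, (1.7) (arXiv:2607.09619 p. 3)] -/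
theorem convect_pvAnsatz (α : ℝ) (W : EuclideanSpace ℝ (Fin 3) → EuclideanSpace ℝ (Fin 3))
    (t : ℝ) (x : EuclideanSpace ℝ (Fin 3)) :
    convect (pvAnsatz α (fun y _ => W y) t) (pvAnsatz α (fun y _ => W y) t) x =
      (Real.sqrt (-t))⁻¹ ^ 3 • rotZ (α * -Real.log (-t))
        (convect W W (rotZ (-(α * -Real.log (-t))) ((Real.sqrt (-t))⁻¹ • x))) := by
  set c : ℝ := (Real.sqrt (-t))⁻¹ with hc
  set θ : ℝ := α * -Real.log (-t) with hθ
  set V : EuclideanSpace ℝ (Fin 3) → EuclideanSpace ℝ (Fin 3) :=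
    fun y => rotZLIE θ (W ((rotZLIE θ).symm y)) with hV
  have e : pvAnsatz α (fun y _ => W y) t = fun z => c • V (c • z) := by
    funext z
    simp only [pvAnsatz, hV, rotZLIE_apply, rotZLIE_symm_apply, hc, hθ]
  rw [e, convect_smul_comp_smul V c x, hV, convect_conj_linearIsometryEquiv (rotZLIE θ) W W]
  simp only [rotZLIE_apply, rotZLIE_symm_apply]

/-! ## §3 The kernel of the linearised precessing profile system is trivial -/

/-- **PURE-WAVE EXCLUSION / no bifurcation from the trivial profile.** Let `W` be band-limited
of degree `≤ L`, divergence free, with Type-I tail `‖W(y)‖ ≤ C/(‖y‖ + 1)`, solving the LINEAR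
precessing profile equation `−ΔW + ½W + ½DW·y + αJ₃W + ∇Q = E` for some smooth `Q` and some
co-band-limited `E`. Then `W = 0` — for EVERY rung `L` and EVERY precession rate `α`.
(Steps: the residual is curl-free, hence a gradient `∇h`; `pvAnsatz α W` is then a classical
solution of the homogeneous Stokes system on `(−∞,0)` with a Type-I bound; the ancient Stokes
Liouville theorem kills it; read off at `t = −1`.)
[cite: KochNadirashviliSereginSverak2009, Lemma 3.1 (arXiv:0709.3599v1 p. 7)] -/
theorem eq_zero_of_linearProfile (hW : IsBandLimited L W) (hdiv : VectorCalculus.IsDivFree W)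
    (hQ : ContDiff ℝ ∞ Q) (hE : IsCobandLimited L E)
    (heq : ∀ y, -(Δ W) y + (1 / 2 : ℝ) • W y + (1 / 2 : ℝ) • fderiv ℝ W y y +
      α • angGen 2 W y + gradient Q y = E y)
    (hdec : ∀ y, ‖W y‖ ≤ C / (‖y‖ + 1)) : W = 0 := by
  have hWs : ContDiff ℝ ∞ W := hW.1
  -- Step 1: the linear residual `G` is curl-free
  set G : EuclideanSpace ℝ (Fin 3) → EuclideanSpace ℝ (Fin 3) := fun y =>
    -((1 : ℝ) • (Δ W) y) + (1 / 2 : ℝ) • W y + (1 / 2 : ℝ) • fderiv ℝ W y y + α • angGen 2 W y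
    with hG
  have heq1 : ∀ y, -((1 : ℝ) • (Δ W) y) + (1 / 2 : ℝ) • W y + (1 / 2 : ℝ) • fderiv ℝ W y y +
      α • angGen 2 W y + gradient Q y = E y := fun y => by rw [one_smul]; exact heq y
  have hcurl : curl G = 0 := profileResidual_curl_eq_zero hW hQ hE heq1
  have hGband : IsBandLimited L G := isBandLimited_profileOp hW 1 α
  -- Step 2: `G = ∇h`
  obtain ⟨h, hh, hgrad⟩ := exists_smooth_gradient_eq hGband.1 hcurl
  -- Step 3: `W` solves the exact rotating steady Leray system with pressure `−h` and
  -- "defect" `(W·∇)W`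
  have hnegh : ContDiff ℝ ∞ (fun y => -h y) := hh.neg
  have hgradneg : ∀ y, gradient (fun z => -h z) y = -G y := fun y => by
    have hd : DifferentiableAt ℝ h y := (hh.differentiable (by simp)) y
    rw [← hgrad y]
    show gradient (-h) y = -gradient h y
    simp only [gradient, fderiv_neg, map_neg]
  have hsys : ∀ z, -((1 : ℝ) • (Δ W) z) + (1 / 2 : ℝ) • W z + (1 / 2 : ℝ) • fderiv ℝ W z z +
      α • angGen 2 W z + convect W W z + gradient (fun y => -h y) z = convect W W z := by
    intro z
    rw [hgradneg z]
    simp only [hG]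
    abel
  have hcl := AngularGalerkinLadderPrecessingReduction.isClassicalNSSolutionOn_pvAnsatz_forced
    (ν := (1 : ℝ)) (α := α) hWs hnegh hsys hdiv
  -- Step 4: the force is the solution's own nonlinearity, and the Type-I bound holds
  have hd : ∀ t < (0 : ℝ), ∀ x,
      (fun t x => (Real.sqrt (-t))⁻¹ ^ 3 • rotZ (α * -Real.log (-t))
        (convect W W (rotZ (-(α * -Real.log (-t))) ((Real.sqrt (-t))⁻¹ • x)))) t x =
      convect (pvAnsatz α (fun y _ => W y) t) (pvAnsatz α (fun y _ => W y) t) x :=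
    fun t _ x => (convect_pvAnsatz α W t x).symm
  have hI : ∀ t < (0 : ℝ), ∀ x, ‖pvAnsatz α (fun y _ => W y) t x‖ ≤
      C / (‖x‖ + Real.sqrt (-t)) := fun t ht x => norm_pvAnsatz_le_of_profile hdec ht x
  have hzero := eq_zero_of_classicalStokes_typeI hcl hd hI
  -- read off at `t = −1`
  funext y
  have h1 := hzero (-1) (by norm_num) y
  rw [pvAnsatz_neg_one] at h1
  exact h1

/-- The same statement pointwise. [folklore] -/
theorem eq_zero_of_linearProfile_apply (hW : IsBandLimited L W) (hdiv : VectorCalculus.IsDivFree W)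
    (hQ : ContDiff ℝ ∞ Q) (hE : IsCobandLimited L E)
    (heq : ∀ y, -(Δ W) y + (1 / 2 : ℝ) • W y + (1 / 2 : ℝ) • fderiv ℝ W y y +
      α • angGen 2 W y + gradient Q y = E y)
    (hdec : ∀ y, ‖W y‖ ≤ C / (‖y‖ + 1)) : ∀ y, W y = 0 := fun y => by
  rw [eq_zero_of_linearProfile hW hdiv hQ hE heq hdec]; rfl

/-! ## §4 The card's (S4): a mean–wave profile with zero zonal part is trivial -/

/-- **(S4) PURE-WAVE EXCLUSION in the letters of `Qlwave.IsMeanWaveProfile L n α C 0 W Q₀ Q₁ E₀ E₁`.**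
If the WAVE equation of the mean–wave system holds with zonal part `V = 0` —
`−ΔW + ½W + ½DW·y + αJ₃W + (0·∇)W + (W·∇)0 + ∇Q₁ = E₁` with `E₁` co-band-limited — for a
band-limited divergence-free `W` with the joint tail `‖0 + W(y)‖ ≤ C/(‖y‖ + 1)`, then `W ≡ 0`.
(The fold number `n`, the wave law `J₃²W = −n²W`, the zonal equation and the continuity of the
defects are not needed.) [folklore] -/
theorem pureWave_eq_zero {Q₁ : EuclideanSpace ℝ (Fin 3) → ℝ}
    {E₁ : EuclideanSpace ℝ (Fin 3) → EuclideanSpace ℝ (Fin 3)}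
    (hW : IsBandLimited L W) (hdiv : VectorCalculus.IsDivFree W) (hQ₁ : ContDiff ℝ ∞ Q₁)
    (hE₁ : IsCobandLimited L E₁)
    (hwave : ∀ y, -(Δ W) y + (1 / 2 : ℝ) • W y + (1 / 2 : ℝ) • fderiv ℝ W y y + α • angGen 2 W y +
      convect (0 : EuclideanSpace ℝ (Fin 3) → EuclideanSpace ℝ (Fin 3)) W y +
      convect W (0 : EuclideanSpace ℝ (Fin 3) → EuclideanSpace ℝ (Fin 3)) y + gradient Q₁ y = E₁ y)
    (hdec : ∀ y, ‖(0 : EuclideanSpace ℝ (Fin 3) → EuclideanSpace ℝ (Fin 3)) y + W y‖ ≤ C / (‖y‖ + 1)) :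
    ∀ y, W y = 0 := by
  have hc1 : ∀ y, convect (0 : EuclideanSpace ℝ (Fin 3) → EuclideanSpace ℝ (Fin 3)) W y = 0 :=
    fun y => by simp [convect]
  have hc2 : ∀ y, convect W (0 : EuclideanSpace ℝ (Fin 3) → EuclideanSpace ℝ (Fin 3)) y = 0 :=
    fun y => by
      rw [convect_apply, show (0 : EuclideanSpace ℝ (Fin 3) → EuclideanSpace ℝ (Fin 3)) =
        fun _ => (0 : EuclideanSpace ℝ (Fin 3)) from rfl, fderiv_fun_const]
      rfl
  refine eq_zero_of_linearProfile_apply (α := α) (C := C) hW hdiv hQ₁ hE₁ (fun y => ?_) (fun y => ?_)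
  · have h := hwave y
    rw [hc1 y, hc2 y, add_zero, add_zero] at h
    exact h
  · have h := hdec y
    rwa [Pi.zero_apply, zero_add] at h

/-- **Both parts of a mean–wave witness are load-bearing (wave side).** In the letters of the
line: if the wave equation with zonal part `V` holds and `W ≢ 0`, then `V ≢ 0` — contrapositive of
`pureWave_eq_zero` (a witness of stub 3 with `V ≡ 0` would be a non-trivial pure wave).
[folklore] -/
theorem zonal_ne_zero_of_wave_ne_zero {V : EuclideanSpace ℝ (Fin 3) → EuclideanSpace ℝ (Fin 3)}
    {Q₁ : EuclideanSpace ℝ (Fin 3) → ℝ} {E₁ : EuclideanSpace ℝ (Fin 3) → EuclideanSpace ℝ (Fin 3)}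
    (hW : IsBandLimited L W) (hdiv : VectorCalculus.IsDivFree W) (hQ₁ : ContDiff ℝ ∞ Q₁)
    (hE₁ : IsCobandLimited L E₁)
    (hwave : ∀ y, -(Δ W) y + (1 / 2 : ℝ) • W y + (1 / 2 : ℝ) • fderiv ℝ W y y + α • angGen 2 W y +
      convect V W y + convect W V y + gradient Q₁ y = E₁ y)
    (hdec : ∀ y, ‖V y + W y‖ ≤ C / (‖y‖ + 1)) (hne : ∃ y, W y ≠ 0) : ∃ y, V y ≠ 0 := by
  by_contra hV
  push Not at hV
  have hV0 : V = 0 := funext hV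
  subst hV0
  obtain ⟨y, hy⟩ := hne
  exact hy (pureWave_eq_zero hW hdiv hQ₁ hE₁ hwave hdec y)

end Summit.NavierStokesRegularity.AngularGalerkinLadderPureWaveExclusion

end
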